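import Summits.QuantumFields.YangMills.Theorems.LuscherReductionTwistedTraceScalingBOCentralRates
import HarnessLib

/-!
# (B-O) central tube — the transport exponent with a slow WINDOW (`δ = β^{-1/3}`) vanishes along schedule B

Companion of `…BOCentralRates` (which treats the central case `δ = 0`).  For the (C4) assembly the core transfer
`…BOCoreTransferInner.colour_fpFibreTransfer_two_sided_inner` is used at general window points `u', u` with
`‖q(u'_k) − 1‖ ≤ δ`, `‖q(u_k) − 1‖ ≤ δu`, `δ = δu = σ = β^{-1/3}`, so the transport exponent is
`coreEta L β δ (δ + δu) T R Γ σ + coreEps1 L β δ T R + coreEps2 L β δ T R σ` with `δ ≠ 0`.  §1 closed forms at `σ = δ = a`,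
§2 the envelope `≤ K'(L,N)·sℓ⁸` (`a = s²`, `α ≤ 2s`, `βΓ ≤ N`), §3 ★ the schedule instantiation `→ 0`.
-/

open MeasureTheory Filter Topology Real
open scoped BigOperators
open Literature.MathematicalPhysics.QuantumFieldTheory
open Literature.MathematicalPhysics.QuantumLattice

namespace Summit.QuantumFields.YangMills.Theorems.FemtoTransferGap.TwoLattice.ConstTube

open Summit.QuantumFields.YangMills.Theorems.FemtoTransferGap
open Summit.QuantumFields.YangMills.Theorems.FemtoTransferGap.TwoLattice
open Summit.QuantumFields.YangMills.Theorems.FemtoTransferGap.TwoLattice.Cov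

variable {L : ℕ} [NeZero L]

/-! ## §1 Closed forms at `σ = δ = a` -/

/-- Closed form of `ε₁` at `δ = a`. [folklore] -/
theorem coreEps1_delta (β a T R : ℝ) :
    coreEps1 L β a T R = 288 * (Fintype.card (Edge 3 L) : ℝ) * a * (β * T ^ 2) + 160 * (Fintype.card (Plaquette 3 L × Fin 3) : ℝ) * a * (β * R ^ 2) := by
  unfold coreEps1; ring

/-- Closed form of `η` at `σ = δ = a`, general `α`. [folklore] -/
theorem coreEta_delta (β a α T R Γ : ℝ) :
    coreEta L β a α T R Γ a =
      (Fintype.card (Edge 3 L) : ℝ) * (558 * α ^ 2 + 192 * α) * (β * T ^ 2) + 216 * α * a * (β * Γ) +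
        50 * a * (Fintype.card (Plaquette 3 L × Fin 3) : ℝ) * (β * R ^ 2) +
        (Fintype.card (Plaquette 3 L) : ℝ) * (1728 * (β * T ^ 2) * Real.sqrt a + 29376 * (β * T ^ 2) * T + 700569 * (β * T ^ 2) * T ^ 2) +
        5040 * α * (Fintype.card (Plaquette 3 L × Fin 3) : ℝ) * (β * R ^ 2) := by
  unfold coreEta stepActionErr; ring

/-- Closed form of `ε₂` at `σ = δ = a`. [folklore] -/
theorem coreEps2_delta (β a T R : ℝ) :
    coreEps2 L β a T R a =
      576 * (Fintype.card (Edge 3 L) : ℝ) * a ^ 2 * (β * T ^ 2) + 50 * a * (Fintype.card (Plaquette 3 L × Fin 3) : ℝ) * (β * R ^ 2) +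
        (Fintype.card (Plaquette 3 L) : ℝ) * (1728 * (β * T ^ 2) * Real.sqrt a + 29376 * (β * T ^ 2) * T + 700569 * (β * T ^ 2) * T ^ 2) +
        (Fintype.card (Plaquette 3 L) : ℝ) * (29376 * (β * T ^ 2) * T + 700569 * (β * T ^ 2) * T ^ 2) +
        145000000 * (Fintype.card (Plaquette 3 L × Fin 3) : ℝ) * a ^ 2 * (β * R ^ 2) := by
  have hNP : Real.sqrt (Fintype.card (Plaquette 3 L × Fin 3) : ℝ) ^ 2 = (Fintype.card (Plaquette 3 L × Fin 3) : ℝ) :=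
    Real.sq_sqrt (Nat.cast_nonneg _)
  unfold coreEps2 stepActionErr
  rw [Real.sqrt_zero]
  have e : (10 * Real.sqrt (Fintype.card (Plaquette 3 L × Fin 3) : ℝ) * R) ^ 2 =
      100 * (Real.sqrt (Fintype.card (Plaquette 3 L × Fin 3) : ℝ) ^ 2) * R ^ 2 := by ring
  rw [e, hNP]; ring

/-! ## §2 The envelope -/

set_option maxHeartbeats 800000 in
-- eleven monomial bounds by `gcongr` plus the closing `linarith` exceed the default budget (the `δ = 0` version
-- `coreExp_le_envelope` has five).
/-- The explicit envelope constant `K'(L, N)` of the transport exponent with a slow window. [folklore] -/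
theorem coreExp_le_envelope_delta {β a s α x ℓ T R Γ N : ℝ} (hβ0 : 0 ≤ β) (hs0 : 0 ≤ s) (hs1 : s ≤ 1) (has : a = s ^ 2)
    (hα0 : 0 ≤ α) (hα : α ≤ 2 * s) (hx0 : 0 ≤ x) (hxs : x ≤ s)
    (hℓ : 1 ≤ ℓ) (hT0 : 0 ≤ T) (hT : T ≤ 46 * L * x * ℓ ^ 2) (hβx : β * x ^ 2 ≤ 1) (hR0 : 0 ≤ R) (hR : R ≤ x * ℓ) (hΓ0 : 0 ≤ Γ)
    (hΓ : β * Γ ≤ N) :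
    coreEta L β a α T R Γ a + coreEps1 L β a T R + coreEps2 L β a T R a ≤
      ((Fintype.card (Edge 3 L) : ℝ) * 2616 * (2116 * (L : ℝ) ^ 2) + 432 * N + 10130 * (Fintype.card (Plaquette 3 L × Fin 3) : ℝ) +
          2 * ((Fintype.card (Plaquette 3 L) : ℝ) * (2116 * (L : ℝ) ^ 2) * (1728 + 29376 * (46 * L) + 700569 * (2116 * (L : ℝ) ^ 2))) +
          288 * (Fintype.card (Edge 3 L) : ℝ) * (2116 * (L : ℝ) ^ 2) + 160 * (Fintype.card (Plaquette 3 L × Fin 3) : ℝ) +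
          576 * (Fintype.card (Edge 3 L) : ℝ) * (2116 * (L : ℝ) ^ 2) + 50 * (Fintype.card (Plaquette 3 L × Fin 3) : ℝ) +
          (Fintype.card (Plaquette 3 L) : ℝ) * (2116 * (L : ℝ) ^ 2) * (29376 * (46 * L) + 700569 * (2116 * (L : ℝ) ^ 2)) +
          145000000 * (Fintype.card (Plaquette 3 L × Fin 3) : ℝ)) * (s * ℓ ^ 8) := by
  rw [coreEta_delta, coreEps1_delta, coreEps2_delta]
  set E := (Fintype.card (Edge 3 L) : ℝ) with hEdef
  set NP := (Fintype.card (Plaquette 3 L × Fin 3) : ℝ) with hNPdef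
  set Npl := (Fintype.card (Plaquette 3 L) : ℝ) with hNpldef
  have hE : 0 ≤ E := Nat.cast_nonneg _
  have hNP : 0 ≤ NP := Nat.cast_nonneg _
  have hNpl : 0 ≤ Npl := Nat.cast_nonneg _
  have hL0 : (0 : ℝ) ≤ L := Nat.cast_nonneg _
  have hℓ0 : 0 ≤ ℓ := by linarith
  have hsa : Real.sqrt a = s := by rw [has, Real.sqrt_sq hs0]
  -- atoms
  have ha0 : 0 ≤ a := by rw [has]; positivity
  have has' : a ≤ s := by rw [has]; nlinarith
  have ha2 : a ^ 2 ≤ s := by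
    have : a ^ 2 ≤ a := by rw [sq]; exact mul_le_of_le_one_left ha0 (has'.trans hs1)
    exact this.trans has'
  have hx1 : x ≤ 1 := hxs.trans hs1
  have hx2 : x ^ 2 ≤ s := by nlinarith
  have hℓ2 : 1 ≤ ℓ ^ 2 := one_le_pow₀ hℓ
  have hℓ4 : ℓ ^ 4 ≤ ℓ ^ 8 := pow_le_pow_right₀ hℓ (by norm_num)
  have hℓ28 : ℓ ^ 2 ≤ ℓ ^ 8 := pow_le_pow_right₀ hℓ (by norm_num)
  have hℓ68 : ℓ ^ 6 ≤ ℓ ^ 8 := pow_le_pow_right₀ hℓ (by norm_num)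
  have hT2 : β * T ^ 2 ≤ 2116 * (L : ℝ) ^ 2 * ℓ ^ 4 := by
    have h1 : T ^ 2 ≤ (46 * L * x * ℓ ^ 2) ^ 2 := pow_le_pow_left₀ hT0 hT 2
    calc β * T ^ 2 ≤ β * (46 * L * x * ℓ ^ 2) ^ 2 := mul_le_mul_of_nonneg_left h1 hβ0
      _ = 2116 * (L : ℝ) ^ 2 * ℓ ^ 4 * (β * x ^ 2) := by ring
      _ ≤ 2116 * (L : ℝ) ^ 2 * ℓ ^ 4 * 1 := by gcongr
      _ = _ := by ring
  have hβT0 : 0 ≤ β * T ^ 2 := by positivity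
  have hR2 : β * R ^ 2 ≤ ℓ ^ 2 := by
    have h1 : R ^ 2 ≤ (x * ℓ) ^ 2 := pow_le_pow_left₀ hR0 hR 2
    calc β * R ^ 2 ≤ β * (x * ℓ) ^ 2 := mul_le_mul_of_nonneg_left h1 hβ0
      _ = ℓ ^ 2 * (β * x ^ 2) := by ring
      _ ≤ ℓ ^ 2 * 1 := by gcongr
      _ = _ := by ring
  have hβR0 : 0 ≤ β * R ^ 2 := by positivity
  have hTs : T ≤ 46 * L * s * ℓ ^ 2 := hT.trans (by gcongr)
  have hT2s : T ^ 2 ≤ 2116 * (L : ℝ) ^ 2 * s * ℓ ^ 4 := by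
    have h1 : T ^ 2 ≤ (46 * L * x * ℓ ^ 2) ^ 2 := pow_le_pow_left₀ hT0 hT 2
    calc T ^ 2 ≤ (46 * L * x * ℓ ^ 2) ^ 2 := h1
      _ = 2116 * (L : ℝ) ^ 2 * x ^ 2 * ℓ ^ 4 := by ring
      _ ≤ 2116 * (L : ℝ) ^ 2 * s * ℓ ^ 4 := by gcongr
  rw [hsa]
  -- term bounds
  have hN0 : 0 ≤ N := le_trans (by positivity) hΓ
  have hα2 : α ≤ 2 := by linarith
  have hαsq : α ^ 2 ≤ 4 * s := by nlinarith
  have t1 : E * (558 * α ^ 2 + 192 * α) * (β * T ^ 2) ≤ E * 2616 * (2116 * (L : ℝ) ^ 2) * (s * ℓ ^ 8) := by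
    have h1 : 558 * α ^ 2 + 192 * α ≤ 2616 * s := by linarith
    have h0 : 0 ≤ 558 * α ^ 2 + 192 * α := by positivity
    calc E * (558 * α ^ 2 + 192 * α) * (β * T ^ 2) ≤ E * (2616 * s) * (2116 * (L : ℝ) ^ 2 * ℓ ^ 4) := by gcongr
      _ = E * 2616 * (2116 * (L : ℝ) ^ 2) * (s * ℓ ^ 4) := by ring
      _ ≤ E * 2616 * (2116 * (L : ℝ) ^ 2) * (s * ℓ ^ 8) := by gcongr
  have tΓ : 216 * α * a * (β * Γ) ≤ 432 * N * (s * ℓ ^ 8) := by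
    have ha1 : a ≤ 1 := has'.trans hs1
    have hβΓ0 : 0 ≤ β * Γ := by positivity
    have hsl : s ≤ s * ℓ ^ 8 := le_mul_of_one_le_right hs0 (one_le_pow₀ hℓ)
    calc 216 * α * a * (β * Γ) ≤ 216 * (2 * s) * 1 * N := by gcongr
      _ = 432 * N * s := by ring
      _ ≤ 432 * N * (s * ℓ ^ 8) := by gcongr
  have t2b : 5040 * α * NP * (β * R ^ 2) ≤ 10080 * NP * (s * ℓ ^ 8) := by
    calc 5040 * α * NP * (β * R ^ 2) ≤ 5040 * (2 * s) * NP * ℓ ^ 2 := by gcongr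
      _ = 10080 * NP * (s * ℓ ^ 2) := by ring
      _ ≤ 10080 * NP * (s * ℓ ^ 8) := by gcongr
  have e1a : 288 * E * a * (β * T ^ 2) ≤ 288 * E * (2116 * (L : ℝ) ^ 2) * (s * ℓ ^ 8) := by
    calc 288 * E * a * (β * T ^ 2) ≤ 288 * E * s * (2116 * (L : ℝ) ^ 2 * ℓ ^ 4) := by gcongr
      _ = 288 * E * (2116 * (L : ℝ) ^ 2) * (s * ℓ ^ 4) := by ring
      _ ≤ 288 * E * (2116 * (L : ℝ) ^ 2) * (s * ℓ ^ 8) := by gcongr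
  have e1b : 160 * NP * a * (β * R ^ 2) ≤ 160 * NP * (s * ℓ ^ 8) := by
    calc 160 * NP * a * (β * R ^ 2) ≤ 160 * NP * s * ℓ ^ 2 := by gcongr
      _ = 160 * NP * (s * ℓ ^ 2) := by ring
      _ ≤ 160 * NP * (s * ℓ ^ 8) := by gcongr
  have e2a : 576 * E * a ^ 2 * (β * T ^ 2) ≤ 576 * E * (2116 * (L : ℝ) ^ 2) * (s * ℓ ^ 8) := by
    calc 576 * E * a ^ 2 * (β * T ^ 2) ≤ 576 * E * s * (2116 * (L : ℝ) ^ 2 * ℓ ^ 4) := by gcongr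
      _ = 576 * E * (2116 * (L : ℝ) ^ 2) * (s * ℓ ^ 4) := by ring
      _ ≤ 576 * E * (2116 * (L : ℝ) ^ 2) * (s * ℓ ^ 8) := by gcongr
  have e2c : 145000000 * NP * a ^ 2 * (β * R ^ 2) ≤ 145000000 * NP * (s * ℓ ^ 8) := by
    calc 145000000 * NP * a ^ 2 * (β * R ^ 2) ≤ 145000000 * NP * s * ℓ ^ 2 := by gcongr
      _ = 145000000 * NP * (s * ℓ ^ 2) := by ring
      _ ≤ 145000000 * NP * (s * ℓ ^ 8) := by gcongr
  have t2 : 5090 * a * NP * (β * R ^ 2) ≤ 5090 * NP * (s * ℓ ^ 8) := by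
    calc 5090 * a * NP * (β * R ^ 2) ≤ 5090 * s * NP * ℓ ^ 2 := by gcongr
      _ = 5090 * NP * (s * ℓ ^ 2) := by ring
      _ ≤ 5090 * NP * (s * ℓ ^ 8) := by gcongr
  have t3 : Npl * (1728 * (β * T ^ 2) * s + 29376 * (β * T ^ 2) * T + 700569 * (β * T ^ 2) * T ^ 2) ≤
      Npl * (2116 * (L : ℝ) ^ 2) * (1728 + 29376 * (46 * L) + 700569 * (2116 * (L : ℝ) ^ 2)) * (s * ℓ ^ 8) := by
    have i1 : 1728 * (β * T ^ 2) * s ≤ 1728 * (2116 * (L : ℝ) ^ 2 * ℓ ^ 4) * s := by gcongr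
    have i2 : 29376 * (β * T ^ 2) * T ≤ 29376 * (2116 * (L : ℝ) ^ 2 * ℓ ^ 4) * (46 * L * s * ℓ ^ 2) := by gcongr
    have i3 : 700569 * (β * T ^ 2) * T ^ 2 ≤ 700569 * (2116 * (L : ℝ) ^ 2 * ℓ ^ 4) * (2116 * (L : ℝ) ^ 2 * s * ℓ ^ 4) := by gcongr
    have j1 : 1728 * (2116 * (L : ℝ) ^ 2 * ℓ ^ 4) * s ≤ 1728 * (2116 * (L : ℝ) ^ 2) * (s * ℓ ^ 8) := by
      calc 1728 * (2116 * (L : ℝ) ^ 2 * ℓ ^ 4) * s = 1728 * (2116 * (L : ℝ) ^ 2) * (s * ℓ ^ 4) := by ring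
        _ ≤ _ := by gcongr
    have j2 : 29376 * (2116 * (L : ℝ) ^ 2 * ℓ ^ 4) * (46 * L * s * ℓ ^ 2) ≤ 29376 * (46 * L) * (2116 * (L : ℝ) ^ 2) * (s * ℓ ^ 8) := by
      calc 29376 * (2116 * (L : ℝ) ^ 2 * ℓ ^ 4) * (46 * L * s * ℓ ^ 2) = 29376 * (46 * L) * (2116 * (L : ℝ) ^ 2) * (s * ℓ ^ 6) := by ring
        _ ≤ _ := by gcongr
    have j3 : 700569 * (2116 * (L : ℝ) ^ 2 * ℓ ^ 4) * (2116 * (L : ℝ) ^ 2 * s * ℓ ^ 4) =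
        700569 * (2116 * (L : ℝ) ^ 2) * (2116 * (L : ℝ) ^ 2) * (s * ℓ ^ 8) := by ring
    have hsum : 1728 * (β * T ^ 2) * s + 29376 * (β * T ^ 2) * T + 700569 * (β * T ^ 2) * T ^ 2 ≤
        (2116 * (L : ℝ) ^ 2) * (1728 + 29376 * (46 * L) + 700569 * (2116 * (L : ℝ) ^ 2)) * (s * ℓ ^ 8) := by
      have := add_le_add (add_le_add (i1.trans j1) (i2.trans j2)) (i3.trans_eq j3)
      refine this.trans (le_of_eq ?_); ring
    calc Npl * (1728 * (β * T ^ 2) * s + 29376 * (β * T ^ 2) * T + 700569 * (β * T ^ 2) * T ^ 2)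
        ≤ Npl * ((2116 * (L : ℝ) ^ 2) * (1728 + 29376 * (46 * L) + 700569 * (2116 * (L : ℝ) ^ 2)) * (s * ℓ ^ 8)) :=
          mul_le_mul_of_nonneg_left hsum hNpl
      _ = _ := by ring
  have t4 : 50 * a * NP * (β * R ^ 2) ≤ 50 * NP * (s * ℓ ^ 8) := by
    calc 50 * a * NP * (β * R ^ 2) ≤ 50 * s * NP * ℓ ^ 2 := by gcongr
      _ = 50 * NP * (s * ℓ ^ 2) := by ring
      _ ≤ 50 * NP * (s * ℓ ^ 8) := by gcongr
  have t5 : Npl * (29376 * (β * T ^ 2) * T + 700569 * (β * T ^ 2) * T ^ 2) ≤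
      Npl * (2116 * (L : ℝ) ^ 2) * (29376 * (46 * L) + 700569 * (2116 * (L : ℝ) ^ 2)) * (s * ℓ ^ 8) := by
    have i2 : 29376 * (β * T ^ 2) * T ≤ 29376 * (2116 * (L : ℝ) ^ 2 * ℓ ^ 4) * (46 * L * s * ℓ ^ 2) := by gcongr
    have i3 : 700569 * (β * T ^ 2) * T ^ 2 ≤ 700569 * (2116 * (L : ℝ) ^ 2 * ℓ ^ 4) * (2116 * (L : ℝ) ^ 2 * s * ℓ ^ 4) := by gcongr
    have j2 : 29376 * (2116 * (L : ℝ) ^ 2 * ℓ ^ 4) * (46 * L * s * ℓ ^ 2) ≤ 29376 * (46 * L) * (2116 * (L : ℝ) ^ 2) * (s * ℓ ^ 8) := by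
      have : 29376 * (2116 * (L : ℝ) ^ 2 * ℓ ^ 4) * (46 * L * s * ℓ ^ 2) = 29376 * (46 * L) * (2116 * (L : ℝ) ^ 2) * (s * ℓ ^ 6) := by ring
      rw [this]; gcongr
    have j3 : 700569 * (2116 * (L : ℝ) ^ 2 * ℓ ^ 4) * (2116 * (L : ℝ) ^ 2 * s * ℓ ^ 4) =
        700569 * (2116 * (L : ℝ) ^ 2) * (2116 * (L : ℝ) ^ 2) * (s * ℓ ^ 8) := by ring
    have hsum : 29376 * (β * T ^ 2) * T + 700569 * (β * T ^ 2) * T ^ 2 ≤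
        (2116 * (L : ℝ) ^ 2) * (29376 * (46 * L) + 700569 * (2116 * (L : ℝ) ^ 2)) * (s * ℓ ^ 8) := by
      have := add_le_add (i2.trans j2) (i3.trans_eq j3)
      refine this.trans (le_of_eq ?_); ring
    calc Npl * (29376 * (β * T ^ 2) * T + 700569 * (β * T ^ 2) * T ^ 2)
        ≤ Npl * ((2116 * (L : ℝ) ^ 2) * (29376 * (46 * L) + 700569 * (2116 * (L : ℝ) ^ 2)) * (s * ℓ ^ 8)) :=
          mul_le_mul_of_nonneg_left hsum hNpl
      _ = _ := by ring
  linarith [t1, tΓ, t2, t2b, t3, t4, t5, e1a, e1b, e2a, e2c]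

/-! ## §3 ★ Along schedule B -/

/-- ★ **The transport exponent with a slow window vanishes on schedule B**: with `δ = δu = σ = β^{-1/3}` (`α = δ + δu`),
`T = 45L·β^{-1/2}ℓ² + β^{-1}`, `R = min(1/40, β^{-1/2}ℓ)`, `Γ = β^{-1}|Site|`, the exponent `η + ε₁ + ε₂` tends to `0`. [folklore] -/
theorem tendsto_coreExp_schedule_delta :
    Tendsto (fun β : ℝ =>
      coreEta L β (powScale (1 / 3) β) ((powScale (1 / 3) β) + (powScale (1 / 3) β)) (9 * (L : ℝ) * (5 * (powScale (1 / 2) β * btLog β ^ 2)) + powScale 1 β) (min (1 / 40) (powScale (1 / 2) β * btLog β)) (powScale 1 β * Fintype.card (Site 3 L)) (powScale (1 / 3) β) +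
        coreEps1 L β (powScale (1 / 3) β) (9 * (L : ℝ) * (5 * (powScale (1 / 2) β * btLog β ^ 2)) + powScale 1 β) (min (1 / 40) (powScale (1 / 2) β * btLog β)) + coreEps2 L β (powScale (1 / 3) β) (9 * (L : ℝ) * (5 * (powScale (1 / 2) β * btLog β ^ 2)) + powScale 1 β) (min (1 / 40) (powScale (1 / 2) β * btLog β)) (powScale (1 / 3) β)) atTop (𝓝 0) := by
  set K : ℝ := (Fintype.card (Edge 3 L) : ℝ) * 2616 * (2116 * (L : ℝ) ^ 2) + 432 * (Fintype.card (Site 3 L) : ℝ) +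
      10130 * (Fintype.card (Plaquette 3 L × Fin 3) : ℝ) +
      2 * ((Fintype.card (Plaquette 3 L) : ℝ) * (2116 * (L : ℝ) ^ 2) * (1728 + 29376 * (46 * L) + 700569 * (2116 * (L : ℝ) ^ 2))) +
      288 * (Fintype.card (Edge 3 L) : ℝ) * (2116 * (L : ℝ) ^ 2) + 160 * (Fintype.card (Plaquette 3 L × Fin 3) : ℝ) +
      576 * (Fintype.card (Edge 3 L) : ℝ) * (2116 * (L : ℝ) ^ 2) + 50 * (Fintype.card (Plaquette 3 L × Fin 3) : ℝ) +
      (Fintype.card (Plaquette 3 L) : ℝ) * (2116 * (L : ℝ) ^ 2) * (29376 * (46 * L) + 700569 * (2116 * (L : ℝ) ^ 2)) +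
      145000000 * (Fintype.card (Plaquette 3 L × Fin 3) : ℝ) with hKdef
  have hup : Tendsto (fun β : ℝ => K * (powScale (1 / 6) β * btLog β ^ 8)) atTop (𝓝 0) := by
    simpa using (tendsto_powScale_mul_btLog_pow (show (0 : ℝ) < 1 / 6 by norm_num) 8).const_mul K
  refine tendsto_of_tendsto_of_tendsto_of_le_of_le' tendsto_const_nhds hup ?_ ?_
  · filter_upwards [eventually_ge_atTop (1 : ℝ)] with β hβ
    have hβ0 : 0 ≤ β := by linarith
    have hT0 : 0 ≤ (9 * (L : ℝ) * (5 * (powScale (1 / 2) β * btLog β ^ 2)) + powScale 1 β) := by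
      have := powScale_pos (1 / 2) β; have := powScale_pos 1 β; have := one_le_btLog β; positivity
    have hR0 : 0 ≤ (min (1 / 40) (powScale (1 / 2) β * btLog β)) := le_min (by norm_num) (mul_nonneg (powScale_pos _ _).le (by linarith [one_le_btLog β]))
    have ha0 : 0 ≤ (powScale (1 / 3) β) := (powScale_pos _ _).le
    have hΓ0 : 0 ≤ powScale 1 β * Fintype.card (Site 3 L) := by have := powScale_pos 1 β; positivity
    rw [coreEta_delta, coreEps1_delta, coreEps2_delta]
    have := Real.sqrt_nonneg (powScale (1 / 3) β)
    positivity
  · filter_upwards [eventually_ge_atTop (1 : ℝ)] with β hβ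
    have hβ0 : 0 ≤ β := by linarith
    have hℓ := one_le_btLog β
    have hs0 : 0 ≤ powScale (1 / 6) β := (powScale_pos _ _).le
    have hs1 : powScale (1 / 6) β ≤ 1 := powScale_le_one (by norm_num) β
    have has : powScale (1 / 3) β = powScale (1 / 6) β ^ 2 := by
      rw [sq, powScale_mul_powScale]; norm_num
    have has' : powScale (1 / 3) β ≤ powScale (1 / 6) β := powScale_le_powScale (by norm_num) β
    have hα0 : 0 ≤ (powScale (1 / 3) β) + (powScale (1 / 3) β) := by have := powScale_pos (1 / 3) β; positivity
    have hα : (powScale (1 / 3) β) + (powScale (1 / 3) β) ≤ 2 * powScale (1 / 6) β := by linarith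
    have hx0 : 0 ≤ powScale (1 / 2) β := (powScale_pos _ _).le
    have hxs : powScale (1 / 2) β ≤ powScale (1 / 6) β := powScale_le_powScale (by norm_num) β
    have hβx : β * powScale (1 / 2) β ^ 2 ≤ 1 := (mul_powScale_half_sq hβ).le
    have hx1 : powScale (1 / 2) β ≤ 1 := powScale_le_one (by norm_num) β
    have hT0 : 0 ≤ (9 * (L : ℝ) * (5 * (powScale (1 / 2) β * btLog β ^ 2)) + powScale 1 β) := by
      have := powScale_pos 1 β; positivity
    have hT : (9 * (L : ℝ) * (5 * (powScale (1 / 2) β * btLog β ^ 2)) + powScale 1 β) ≤ 46 * L * powScale (1 / 2) β * btLog β ^ 2 := by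
      have e1 : powScale 1 β = powScale (1 / 2) β ^ 2 := (powScale_half_sq' β).symm
      have h1 : powScale 1 β ≤ (L : ℝ) * powScale (1 / 2) β * btLog β ^ 2 := by
        rw [e1, sq]
        have hℓ2 : 1 ≤ btLog β ^ 2 := one_le_pow₀ hℓ
        have hL1 : (1 : ℝ) ≤ L := by exact_mod_cast NeZero.one_le
        calc powScale (1 / 2) β * powScale (1 / 2) β ≤ 1 * powScale (1 / 2) β * 1 := by
              rw [one_mul, mul_one]; exact mul_le_of_le_one_left hx0 hx1
          _ ≤ (L : ℝ) * powScale (1 / 2) β * btLog β ^ 2 := by gcongr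
      linarith
    have hR0 : 0 ≤ (min (1 / 40) (powScale (1 / 2) β * btLog β)) := le_min (by norm_num) (by positivity)
    have hR : (min (1 / 40) (powScale (1 / 2) β * btLog β)) ≤ powScale (1 / 2) β * btLog β := min_le_right _ _
    have hΓ0 : 0 ≤ powScale 1 β * Fintype.card (Site 3 L) := by have := powScale_pos 1 β; positivity
    have hΓ : β * (powScale 1 β * Fintype.card (Site 3 L)) ≤ Fintype.card (Site 3 L) := by
      rw [← mul_assoc, mul_powScale_one hβ, one_mul]
    have h := coreExp_le_envelope_delta (L := L) hβ0 hs0 hs1 has hα0 hα hx0 hxs hℓ hT0 hT hβx hR0 hR hΓ0 hΓ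
    rw [hKdef]
    exact h

end Summit.QuantumFields.YangMills.Theorems.FemtoTransferGap.TwoLattice.ConstTube
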